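import Mathlib
import HarnessLib
import HarnessLib.Audit
import Summits.AnomalousDissipation.Statement
import Literature.Analysis.FluidPDE.SawtoothCascade
import Literature.Analysis.FluidPDE.AnomalousDissipation
import Literature.Analysis.FluidPDE.DEIJTheorem2
import Literature.Analysis.FluidPDE.SawtoothCascadeDriftFree
import Literature.Analysis.FluidPDE.SawtoothCascadeK2Classical

/-!
Route: SawtoothPulseCascade

DORMANT since 2026-09-05T01:59:12Z (reconciler: no traction for 5 d (last activity item-evidence-added at 2026-08-31T01:04:31Z); parked, not closed — `ledger route dormant route-AnomalousDissipation-SawtoothPulseCascade --off` to reacti) — unstaffed, not closed; items shared with open routes are served there. `ledger route dormant <id> --off` reactivates.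

# Route SawtoothPulseCascade — Bounded-strain rounded-sawtooth pulse cascade with a
viscosity-independent Hölder force realises BDL Q2.1

It suffices to show K1loc ∧ K2″ ∧ K3loc for the explicit, ν-INDEPENDENT alternating rounded-sawtooth
shear cascade ū on 𝕋² (landed definitions `Literature.Analysis.FluidPDE.SawtoothCascade`, p410620 +
AMENDMENTS 1–10; integer frequency ratio ρN ∈ {2,…,7}, rounding δ_j = ¼·2^{-j}, half-pulse durations
45/(π⁴(j+1)⁴) summing to 1; strain γ ∈ [5,8] per half-pulse for the scalar and closure items, γ ∈
[4,8] ⊇ [5,8] for the stability item): (K1loc, rev 5) the cascade field is smooth on [0,1) × 𝕋² and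
the viscous cascade scalar from the planar datum sin 2πx₁ has dissipated a κ-INDEPENDENT fraction χ
of its variance BY THE THRESHOLD TIME tStart(J_{γ²−3}(κ) + A) — tree predicate
`SawtoothCascade.K1Localised P (γ² − 3)` (Part 8, p417709), where J_r(κ) = ⌈log(1/κ)/(2 log r)⌉₊
(`SawtoothCascade.Jrate`) and γ² − 3 is the tree-certified growth floor of scalar gradients per
pulse pair off the corner strips (`SawtoothCascade.itinJac_growth_routeBox`, Part 7, p416950); it
implies the rev-0 by-t = 1 statement (`K1FixedFraction_of_K1Localised`), which the closure cannot
consume (ROUND-3 finding F1: the Navier–Stokes perturbation is controlled only up to the dissipation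
phase); (K2″, unchanged) every residual-class (shear-comb) injection is amplified by the
Navier–Stokes flow linearised at the cascade by at most 3·e^{σ⋆γ} per phase (σ⋆ = 0.30982 =
`sawSigmaStar`, the certified maximal Kelvin–Helmholtz rate of the exact sawtooth per unit strain),
uniformly in ν ∈ (0, ν₀] — `K2PhaseGrowth` (AMENDMENT 1, p410857); (K3loc, rev 5) K1loc and K2″ give
the route's TARGET by the LOCALISED energy comparison of ROUND-3 §4 (planar NS perturbation slaved
phase by phase under the cap, scalar comparison ‖θ_ν − θ̄_ν‖(t) ≤ ∫₀ᵗ‖v_ν‖_{L²}‖∇θ̄_ν‖_{L^∞} on [0,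
tStart(J_{γ²−3}(ν)+A)] only, whose geometric cost series converges because of the numerical window
3e^{σ⋆γ}·‖B(γ)‖ < (γ² − 3)² on γ ∈ [5,8] — support item ClosureMargin58, ‖B(γ)‖ = ((γ²+2) +
√((γ²+2)² − 4))/2 the sup-gradient envelope per pulse pair, ratios 0.787 / 0.671 / 0.634 at γ = 5 /
6 / 8, sup 0.7867, and it FAILS at γ = 4 (185.9 > 169), whence the box [5,8]; 2½-D lift): the class
rung BDLQ21Holder = Brué–De Lellis Question 2.1 with a Hölder force (VARIANT S of the director's
kit: item `Target` carries the leaf's body verbatim; the deciding theorem `closes : K1loc → K2″ →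
K3loc → Target` is modus ponens (three crux-kind binders, crux-only admissible); the route stays
draft with `glue.conclusion-mismatch` until the prover-landed leaf
`Summit.AnomalousDissipation.AnomalousDissipation.BDLQ21Holder` is listed as ALT-CLOSER and
`--closes-target` is set). The rev-0 items K1BoundedStrainCascade (by-t = 1 mixing on [4,8]) and
K3NonlinearClosure (K1 → K2″ → Target) are kept in the file as ASIDES (never staffed): the second
follows from K1loc ∧ K3loc by pure logic (`K3NonlinearClosure_of_loc`,
HOME/ad-ideate-p2/e4/Sketch4.lean), the first is no longer load-bearing and its t-uniform
balanced-growth line is predicted false by the fixed-strain intermittency F2 (ROUND-3-SUPPLEMENT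
§1–2, TEST D). This is a RUNG (class F-D1), not the summit ZerothLaw.
Lean: `(∀ γ ∈ Set.Icc (5 : ℝ) 8, ∀ ρN ∈ Finset.Icc 2 7,
Literature.Analysis.FluidPDE.SawtoothCascade.CascadeFieldSmooth ⟨γ, 1 / 4, 2, 1, ρN⟩ ∧
Literature.Analysis.FluidPDE.SawtoothCascade.K1Localised ⟨γ, 1 / 4, 2, 1, ρN⟩ (γ ^ 2 - 3)) ∧ (∀ γ ∈
Set.Icc (4 : ℝ) 8, ∀ ρN ∈ Finset.Icc 2 7, Literature.Analysis.FluidPDE.SawtoothCascade.K2PhaseGrowth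
⟨γ, 1 / 4, 2, 1, ρN⟩ 3)`

## Assembly
Pure logic: K3LocalisedClosure is typed as the implication K1LocalisedCascade →
K2LinearisedCascadeGrowth → Target, so the deciding theorem is `theorem closes (hK1 :
K1LocalisedCascade) (hK2 : K2LinearisedCascadeGrowth) (hK3 : K3LocalisedClosure) : Target := hK3 hK1
hK2` (rev 5 glue: three binders, all crux-kind, all consumed by the proof term — crux-only
admissible; the numerical window ClosureMargin58 and SawtoothSigmaMax are support items in-cone as
registered stubs of the K3loc / K2″ lines; the `Assembly` item — which the gate allows neither to
drop nor to retriage — is RESTATED (rev 8) as the rev-5 modus ponens K1LocalisedCascade →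
K2LinearisedCascadeGrowth → K3LocalisedClosure → Target and is NOT a binder of `closes`, so the
tribunal kernel's former Assembly chips (t1c-degenerate etc.) have nothing to attach to). VARIANT S:
`closes` concludes the item `Target` (= the leaf BDLQ21Holder verbatim), so the route carries
`glue.conclusion-mismatch` as its only code; after a prover lands `Theorems/BDLQ21Holder.lean
--supports <Target item>` and the director lists the ALT-CLOSER, `ledger route edit <route-id>
--closes-file glue.lean --closes-target
Summit.AnomalousDissipation.AnomalousDissipation.BDLQ21Holder` serves it. Registered skeletons (farm
rc 0, sorries = stubs): K2″ birth (stmt-AnomalousDissipation-20025: stub_sawtoothSigmaMax = tree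
`sq_mul_neg_sawC2zero_le`, stub_linearisedGrowth, stub_rung_parallelHalfPulse); K3loc
`Cruxes.K3LocalisedClosure.Loc58` (5 stubs: S0 the window = ClosureMargin58 verbatim, packaging,
sawtooth toolkit, planar slaving under the cap, localised closure = the heart; `window_of_margin`
and `rhoN_le_cap` proved inside); K1loc `Cruxes.K1LocalisedCascade.Spectral` (2 stubs:
horizontal-mode damping across an H half-slot, provable now; high horizontal-mode concentration at
the threshold phase = the heart; field smoothness is CITED from the tree, `cascadeFieldSmooth`,
p424921; the ENNReal energy bookkeeping `energyIdentityE` and the composition proved inside).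

CLOSES_TARGET: closes rung F-D1.BDL of AnomalousDissipation: Summit.AnomalousDissipation.AnomalousDissipation.Theses.SawtoothPulseCascade.Target (D-0061; not the summit Statement) — the deciding theorem of this route concludes that registered leaf instead of the Statement decl `AnomalousDissipation` (class rung: servable and labelled, never counted as concluding the summit Statement).

UNDER FLOOR: fewer than 2 cruxes remain after retriage (legacy route; D-0019).

Rationale: WHY THIS LINE. Brué–De Lellis (BrueDeLellisCMP2023, §3–4), BCCDS (arXiv:2212.08413, OQ1) and
Johansson–Sorella (JohanssonSorella2024 = arXiv:2409.03599, Thm 1.5: autonomous but ν-dependent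
forces F_νq → F₀ in C^α, answering BDL Q2.2/2.3) realise anomalous dissipation with forces that
depend on ν; BDL Question 2.1 asks for a force independent of ν. The lever (ad-ideate-p2
ROUND-1/2/3): take the force to be LITERALLY ∂ₜ of an exact inviscid shear cascade, so that all
ν-dependence becomes a dynamical Navier–Stokes error, and control that error by a linear
hydrodynamic-stability BUDGET — the per-phase Kelvin–Helmholtz amplification 3e^{σ⋆γ} of the
linearised flow against the per-pulse-pair growth of the scalar gradients the cascade produces.
ROUND-3 (HOME/ad-ideate-p2/ROUND-3.md, ROUND-3-SUPPLEMENT.md; referee PASS ×3) sharpened the budget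
in two ways that rev 5 types: (F1, localisation) the perturbation v_ν = u_ν − ū is controlled only
up to the dissipation phase J(ν) + A, so the scalar comparison is an L² energy estimate on [0,
tStart(J(ν)+A)] whose cost series converges iff 3e^{σ⋆γ}·‖B(γ)‖ < r², r a PARCEL-UNIFORM growth
floor of |∇θ̄| per pulse pair and ‖B(γ)‖ = ((γ²+2)+√((γ²+2)²−4))/2 the sup envelope; (F2,
intermittency) at fixed strain the two sign classes of pulse pairs have exponents log of (γ² ± 2 ±
…), so log|∇θ̄| spreads like σ₁√j and NO t-uniform balanced growth holds inside the KH window — the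
closure therefore uses no balanced growth and no duality, only the floor. The tree certifies the
floor r = γ² − 3 for every itinerary off the corner strips (`SawtoothCascade.itinJac_growth_two`,
`itinJac_growth_routeBox`, Part 7 p416950: invariant coordinate cones), and the window
3e^{σ⋆γ}‖B(γ)‖ < (γ²−3)² holds on γ ∈ [5,8] (ratios 0.787/0.671/0.634 at γ = 5/6/8) and FAILS at γ =
4 (185.9 > 169): hence the rev-5 box [5,8] for the scalar/closure items (K2″ keeps [4,8]). Imported:
classical Rayleigh stability of piecewise-linear shear layers (Drazin 2002 pp. 110–115) in closed
PRODUCT form for the periodic triangular array with Bloch phase (three certified lineages for σ⋆;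
tree `sq_mul_neg_sawC2zero_le`); the tree's classical linearised-NS half-pulse energy bound
(`CascadeParams.linearised_energy_le_of_mem_H/V`, AMENDMENT 10 p423856) and Kelvin-mode transport
(`KelvinMode.scalarMode_transport`, p422708) for K2″; the tree's classical scalar energy identity
(`Torus.IsClassicalScalarTransportOn.scalarL2Sq_add_scalarDissipation_holds`,
`Torus.eScalarDissipation_eq_ofReal`) for K1loc; the tree's 2½-D packaging
`Torus.isClassicalNSSolutionOn_twoHalf` for K3loc. No prior route of the summit uses a fixed force
with a stability budget; the negatives index has no statement of this shape.

RANKED CRUXES. #0 Target (target) — the class rung BDLQ21Holder (Brué–De Lellis Question 2.1 with a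
Hölder force), body VERBATIM from the referee-endorsed leaf HOME/ad-ideate-p2/leaf/BDLQ21Holder.lean
(sha 1986b449): vanishing viscosities ν_m, ONE smooth datum u₀ and ONE ν-independent force f on
[0,1] × T³ — f ∈ C([0,1]; C^α) with sup_t ‖f(t)‖_{C^α} < ∞ for every α < 1 and C^∞ on [0,1) × T³ —
classical solutions on [0,1) that are forced weak solutions on [0,1] from u₀, with non-vanishing
mean dissipation (why it might fail: BDL Q2.1 is open in print: every construction to date (BDL23,
BCCDS, JS24 Thm 1.5, Cheskidov–Peng) needs ν-dependent forces; a Hölder-in-time fixed force may be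
too rigid to drive a singular-time cascade whose viscous error stays perturbative)
[BrueDeLellisCMP2023, arXiv:2212.08413, arXiv:2409.03599]. #2 K2LinearisedCascadeGrowth (crux, box
[4,8], unchanged since rev 0/AMENDMENT 1) — K2″ — every shear-comb residual-class injection at any
phase j₀ is amplified in velocity L², by every weak solution of Navier–Stokes linearised at the
time-shifted cascade carrier (A = 1 passive-vector predicate), by at most (3e^{0.30982γ})^{J−j₀+1}
on phase J ≥ j₀, uniformly in ν ∈ (0, ν₀] [difficulty XL] (why it might fail: the Orr prefactor or
the ROUND-2 §3.9 cross channel compounds above 3e^{σ⋆γ} at some box point; the typed ∃ν₀ precedes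
∀j₀ — ONE viscous threshold for ALL injection phases (F-K2-1); the weak class of the predicate may
be too large (uniqueness); data: per-phase factors of record Λ ≤ 4.95 ≤ cap/2 at every audited box
corner) [BrueDeLellisCMP2023, arXiv:2212.08413, Drazin2002]. #3 K1LocalisedCascade (crux, NEW rev 5,
box [5,8]) — K1loc — field smooth on [0,1) × 𝕋² ∧ `K1Localised ⟨γ,¼,2,1,ρN⟩ (γ²−3)`: ∃ χ > 0, A, κ₀
> 0 such that every classical solution of ∂ₜw + ū·∇w = κΔw on [0,1) from sin 2πx₁, κ ≤ κ₀, has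
2·eScalarDissipation(0, tStart(J_{γ²−3}(κ)+A)) ≥ χ‖sin 2πx₁‖² [difficulty XL] (why it might fail:
the certified floor γ²−3 alone does not do it with a FIXED lag A (tHalf J ~ J⁻⁴ would need r^{2A} ≳
J⁴); the proof must use that the BULK of the variance grows at the typical rate ≈ √(γ⁴−4) > γ²−3 — a
strip-mass / large-deviation estimate across the rounded corners (cells of the first pulses are only
~3 wavelengths wide) — and viscous dephasing between itinerary cells could refill low horizontal
modes) [DEIJ2022, ElgindiLiss2024, JohanssonSorella2024, arXiv:2305.05048]. #4 K3LocalisedClosure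
(crux, NEW rev 5) — K3loc := K1LocalisedCascade → K2LinearisedCascadeGrowth → Target: planar
Navier–Stokes V_ν forced by the ν-independent ∂ₜū from rest stays slaved to ū phase by phase up to
phase J_{γ²−3}(ν) + A (nonlinear remainder under the cap 3e^{σ⋆γ}), the scalar transported by V_ν
with diffusivity ν is L²-close to the cascade scalar on [0, tStart(J+A)] with a geometric cost
series (ratio 3e^{σ⋆γ}‖B(γ)‖/(γ²−3)² < 1 = ClosureMargin58), so K1loc's dissipated fraction survives
(χ/4), and the 2½-D lift u_ν = (V_ν, θ_ν)∘π (tree `Torus.twoHalf`) is the Target's family with f =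
(∂ₜū, 0)∘π (C^∞ on [0,1), Hölder up to t = 1) and u₀ = (0,0,sin 2πx₁)∘π [deps K1LocalisedCascade,
K2LinearisedCascadeGrowth; the window ClosureMargin58 is part of the proof obligation (stub S0 of
the line); difficulty XL] (why it might fail: the nonlinear/residual sources are not exactly
comb-class, the backward realignment of injections to phase starts costs a constant per phase that
must also fit under (γ²−3)², and the forced energy bookkeeping up to t = 1 (force only Hölder there)
could let the planar perturbation carry or cancel dissipation) [BrueDeLellisCMP2023,
JohanssonSorella2024, Drazin2002]. SUPPORTS (rank 9, unranked for staffing; in-cone as registered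
stubs of the K3loc / K2″ lines): ClosureMargin58 (NEW, = stub S0 `stub_closureMargin58` of
`Cruxes.K3LocalisedClosure.Loc58`; elementary real analysis: ∀ γ ∈ [5,8],
3·exp(sawSigmaStar·γ)·((γ²+2)+√((γ²+2)²−4))/2 < (γ²−3)², margins ≥ 21 %, eight monotone
sub-intervals + `Real.exp` bounds suffice — same certificate style as the landed
`sq_mul_neg_sawC2zero_le`); SawtoothSigmaMax (stmt-AnomalousDissipation-19094, a one-line `exact
Literature.Analysis.FluidPDE.SawtoothCascade.sq_mul_neg_sawC2zero_le` since AMENDMENT 4). ASIDES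
(never staffed, kept as context): K1BoundedStrainCascade (rev-0 K1, by-t = 1 mixing on [4,8];
superseded — its by-time-1 conclusion is not what the closure consumes, and its balanced-growth line
is predicted false by F2/TEST D) and K3NonlinearClosure (rev-0 K3′ = K1 → K2″ → Target; implied by
K1loc ∧ K3loc, `K3NonlinearClosure_of_loc`). The Assembly item (not droppable by gate rule) is
restated (rev 8) to K1LocalisedCascade → K2LinearisedCascadeGrowth → K3LocalisedClosure → Target and
is not a binder of closes (provable by `fun a b c => c a b`; optional by D-0027).

TWO-LAYER PLAN. K2LinearisedCascadeGrowth ⇐ registered birth skeleton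
`Cruxes.K2LinearisedCascadeGrowth.Birth` (stub_sawtoothSigmaMax — tree theorem;
stub_linearisedGrowth — frozen-profile modal bound in the strain clock via the landed classical
half-pulse energy bound `linearised_energy_le_of_mem_H/V` + comb-class cocycle + ONE viscous
threshold, the hardest stub; stub_rung_parallelHalfPulse — the BC5 rung). K1LocalisedCascade ⇐ new
skeleton `Cruxes.K1LocalisedCascade.Spectral`
(HOME/ad-ideate-p2/route/lines/K1LocalisedCascade_spectral.lean, farm rc 0, 2 sorries = 2 stubs): S1
field smoothness is CITED (tree `cascadeFieldSmooth`, ad-lit p424921); S2 stub_shearSlotDamping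
(provable now: on an H half-slot the field is ONE horizontal shear (Part 9), so horizontal Fourier
fibres decouple, the advection is skew on each, and the modes |k₁| ≥ K lose the fraction 1 −
e^{−8π²κK²·tHalf j}); S3 stub_highModeConcentration (the heart: at the start of phase J_{γ²−3}(κ)+A
at least 2χ‖θ₀‖² sits in horizontal modes |k₁| ≥ K with 8π²κK²tHalf J ≥ 1, unless already
dissipated); composition `K1LocalisedCascade_of` PROVED (ENNReal energy bookkeeping with the tree
identity, lag A+1). K3LocalisedClosure ⇐ new skeleton `Cruxes.K3LocalisedClosure.Loc58`
(route/lines/K3LocalisedClosure_loc58.lean, farm rc 0, 5 sorries = 5 stubs): stub_closureMargin58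
(S0, the window = support item ClosureMargin58 verbatim, provable now), stub_packaging (force/datum
regularity, lift), stub_toolkit (sawtooth geometry: sup envelope ‖B(γ)‖ per pulse pair, comb class
of ∂ₜū-driven residuals), stub_planarSlaving (K2″ cap ⇒ ‖v_ν‖ phase envelope up to J+A, nonlinear
remainder absorbed), stub_localisedClosure (the heart: energy comparison + geometric series under
`window_of_margin`, derived from S0 inside the file) → K3loc.

KILL CRITERIA. K2LinearisedCascadeGrowth refuted by a certified per-phase factor > 3e^{σ⋆γ} inside
the box (instrument lineage B = eng W-p2-4, or an exact non-modal computation), or by an F-K2-1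
witness (no single ν₀ serving all injection phases) ⇒ restate once (C(γ) = c₀γ per the TEST A″
rider; or ν₀ allowed to depend on j₀ with the K3loc bookkeeping re-derived) or close
refuted:K2LinearisedCascadeGrowth if the factor exceeds (γ²−3)²/‖B(γ)‖ itself. K1LocalisedCascade
refuted at a corner (γ, ρN) (e.g. a certified viscous computation showing the dissipated fraction by
tStart(J_{γ²−3}(κ)+A) → 0 along κ → 0 for every A) ⇒ shrink the box by route edit (the window has
slack down to γ ≈ 4.22: ratio 1 at γ ≈ 4.218, referee gen-14 verification; sup ratio on [5,8] =
0.7867 at γ = 5), not the route; refuted on all of [5,8] ⇒ the fixed-strain cascade does not mix in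
time and the line is dead (close refuted:K1LocalisedCascade). ClosureMargin58 is decidable numerics
(margin ≥ 21 %); were it false the rate/box would be re-chosen, not the route closed.
K3LocalisedClosure refuted (a counterexample to the implication) closes the route outright. A landed
ν-independent-force construction elsewhere moots it (close superseded).

NOT DECOMPOSED YET. Inside stub_linearisedGrowth: the comb-class cocycle and the viscous-threshold
uniformity (F-K2-1), and the uniqueness/energy class of the weak linearised solutions (the classical
restatement via `linearised_energy_le_of_mem_H/V` is the intended first cut; origin shift tStart j
vs tInject-shifted clock is p2-side glue). Inside stub_highModeConcentration: the strip-mass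
summability across rounded corners (SUPPLEMENT §4) and the bulk-rate large deviation (typical rate >
floor) — deliberately one stub until a crux-plan seat cuts it. Inside stub_localisedClosure: the
realignment constant of backward-dispersed injections and the t → 1 Hölder bookkeeping of f. These
are layer-2 children or prover-attached lemmas (`--supports`), never items now. TREE THEOREMS
citable BY NAME (do not restate; BC4): Parts 2–11 of `SawtoothCascade` (timing lemmas tHalf_pos …
tStart_add_tHalf_lt_one; sawC2 product/half-angle/band criteria; `sq_mul_neg_sawC2zero_le`; cones
and `itinJac_growth_routeBox`; `Jrate`, `K1Localised`, `eScalarDissipation_mono_right`,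
`K1FixedFraction_of_K1Localised`; single-shear-per-half-slot structure; slopes |U_j′| ≤ 1;
`isDivFree_field_of_mem_H/V`, `integral_rateH_le`, `linearised_energy_le_of_mem_H/V`),
`TorusLinearisedNSShear` (p421585), `ScalarKelvinMode` (p422708).

CHEAPEST FALSIFIER. (i) In Lean, now: ClosureMargin58 at the endpoints and the eight sub-interval
corners by `norm_num` + `Real.exp` bounds (a failure would be a typing error of record — the float
margins are 0.787/0.671/0.634); the F-K2-1 quantifier probe on K2PhaseGrowth. (ii) Numerically, of
record (ROUND-3 §4.2/4.2b, RESULT #7/#7b, jobs j247867 + j248157, referee PASS): the linearised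
per-phase factors at the box corners — (4,6): Λ₁, Λ₂ = 3.689 / 3.911 ≤ cap/2 = 5.18, hi-wavenumber
energy fraction ≤ 1e-3 ⇒ R2 STANDS conclusively; (4,7), (5,7): Λ = 3.695/3.936 and 4.945/4.893 ≤
cap/2 but hiwavE 1.9e-3/2.2e-3 just above the 1e-3 resolution side-rule ⇒ UNDECIDED of record
(resolved lineage M = 8192 ≈ 30 core-h, or eng lineage B, would decide; no R1 anywhere ⇒ no edit
forced by the tests). (iii) TEST D (SUPPLEMENT §6, fold D-iii MIXED, referee PASS): the t-uniform
balanced-growth ratio drifts at fixed strain as F2 predicts — this is WHY K1 (aside) is not the crux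
and K1loc is. (iv) eng W-p2-4 lineage-B replication of the (12,2) factors 31.4/18.7/24.1 within ±20
% remains the cheapest external kill of K2″'s constant.

NUMBERS. σ⋆ = 0.309816835054 ± 5e-16 (eng kit j245035 + referee decimal-40 + p2 kit j245896: σ_max ∈
[0.30981, 0.30983]); a_c = 0.76373914287513 (coth x* = x* = 1.19967864026). Rate of record for the
scalar/closure items: r = γ² − 3 on γ ∈ [5,8] (tree floor `itinJac_growth_routeBox`; the sharper
cone rates λ_opt(γ) of ROUND-3-SUPPLEMENT §3 are documented there and NOT used by the items).
Closure window 3e^{σ⋆γ}‖B(γ)‖ vs (γ²−3)²: γ = 5: 380.8 < 484 (0.787); γ = 6: ratio 0.671; γ = 8: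
2360 < 3721 (0.634); γ = 4: 185.9 > 169 (fails) — the rev-0 by-t = 1 window {3e^{σ⋆γ} < γ² − 2} =
(3.160, 12.946) and, for the conjectured constant 1.25, ≈ (2.0959, 17.872) ⊃ (2.5, 17.7) of ROUND-2
(left end ≈ 2.0959 — certified bracket (2.09590, 2.09594) over σ_max ∈ [0.30981, 0.30983], referee
E-g11-1 refinement), are superseded as closure criteria but remain the K2″-vs-rescaling sanity
check. Measured per-phase factors Λ_i of the linearised cascade (float, lineage A; kit
j244065/j245608, ρN = 2, M1024 ≡ M2048 to ≥ 4 digits): γ = 12 phys 31.39/18.70/24.10, prop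
31.42/18.31/27.03; γ = 10: 13.21/11.43/10.61; γ = 16: 173.9/40.4; γ = 4: 4.6/3.7/3.4; box corners
(j247867/j248157, M2048/4096): (4,6) 3.689/3.911, (4,7) 3.695/3.936, (5,7) 4.945/4.893, all ≤ cap/2.
TEST A‴ verdict of record: FRESH (Λ₃(12, prop, M2048) = 27.03 ≥ 26) — K2″ stands as filed.

DEFINITION REQUESTS. None open: the definitions file Literature.Analysis.FluidPDE.SawtoothCascade
(p410620 + AMENDMENTS 1–10: sawC2, sawC2zero, sawC2prod, sawSigmaStar, CascadeParams (+ timing,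
bumps, rates, profiles, field, cones, itineraries), datum, CascadeFieldSmooth, K1FixedFraction,
ShearCombDatum, K2PhaseGrowth, Jrate, K1Localised) carries every constant the items use; the rung
leaf Summit.AnomalousDissipation.AnomalousDissipation.BDLQ21Holder
(HOME/ad-ideate-p2/route/kit/BDLQ21Holder.lean) is to be landed by a PROVER/eng seat as
Theorems/BDLQ21Holder.lean --supports <Target item> (eng ask E1), after which `--closes-target`
clears VARIANT S.

Novelty: Searches (2026-08-25): `lit search --hybrid "anomalous dissipation Navier-Stokes force independent
of viscosity alternating shear flows"` (corpus: no relevant hit); `lit search --hybrid "anomalous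
dissipation forced Navier-Stokes smooth force Euler singularity Brue De Lellis" -n 6` (books only:
Frisch 1995, Kuksin–Shirikyan 2012, Majda–Bertozzi 2002 — method background); `lit papers --grep
anomalous` → [corpus:paper:arxiv-2409.03599 p.5 Thm 1.5] Johansson–Sorella (autonomous ν-DEPENDENT
forces, answers BDL Q2.2/Q2.3, not Q2.1), [corpus:paper:arxiv-2603.11466] Bagnara–Boutros–De
Lellis–Mayboroda 2026 (passive-scalar thresholds; grep for ν-independent force: 0 hits);
arXiv/Crossref sweep: arXiv:2605.18126 (stability of the BDL construction, ν-dependent forces),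
arXiv:2303.09486, doi:10.5802/crmath.709, arXiv:2512.24568 (Cheskidov–Peng, forces ν-dependent) —
none ν-independent; `lit galaxy search --star all "viscosity-independent force|viscosity independent
force|independent of the viscosity parameter"` (0 relevant); `lit galaxy search "anomalous
dissipation|zeroth law of turbulence" --star pdf -n 8` (8 hits, none a construction:
Berselli–Chiodaroli energy equality, Dascaliuc–Grujić, Boutros–Markfelder–Titi hydrostatic Onsager);
`lit galaxy search --star pdf "alternating shear flows|alternating shears"` →
[galaxy:pdf:3450849297847216120] (He–Kiselev, unrelated); `lit search --hybrid "linear stability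
piecewise linear periodic shear flow triangular velocity profile Rayleigh equat  [refs: 10.5802/crmath.709, 2605.18126, 2303.09486, 2512.24568, 2409.03599, 2212.08413, 2305.05048, paper:arxiv-2409.03599, paper:arxiv-2603.11466, doi:10.5802/crmath.709, book:drazin2002, BrueDeLellisCMP2023]

Barriers (technique_class: explicit-construction, stability-budget, 2.5D-lift): - technique_class: explicit-construction, stability-budget, 2.5D-lift
- Literature.Barriers.AnomalousDissipation.BrueDeLellis2023_noAnomaly_beforeEulerSingularityNarrow:
evaded honestly — f is C^∞ on [0,1) × T³ and only Hölder up to t = 1; solutions classical on Ico 0 1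
only; the Target is typed on Ico 0 1 accordingly, and the Euler limit ū∘π is singular exactly at t =
1 where the anomaly sits (K3′ inside the class, escaping hypothesis: no classical Euler limit on the
closed interval).
- Literature.Barriers.AnomalousDissipation.BrenierDeLellisSzekelyhidi2011_cor1 (module
MeasureValuedWeakStrong): consistent — on every [0,t], t < 1, ∫₀ᵗ‖∇ū‖_∞ < ∞ and NS_ν → the regular
flow there (content of K3′); total strain diverges only as t → 1.
- Literature.Barriers.AnomalousDissipation.DeRosaDrivasInversi2024_thm12_bounded (module
DissipationSupportLowerBound): consistent — the limiting dissipation measure concentrates on {t = 1}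
× T³ (the sharp case attributed to BDL23/BCCDS24).
- Literature.Barriers.AnomalousDissipation.DrivasElgindiIyerJeong2022_thm4 (module
ObukhovCorrsinThreshold): respected — no uniform L^∞_t C^β bound on the lifted component for any β >
0 is claimed; K1's scalar gradients blow up as t → 1.
- Literature.Barriers.AnomalousDissipation.BardosTitiWiedemann2012_thm5 (module
ShearFlowViscositySelection): not engaged — no inviscid selection/uniqueness claim; each NS_ν
solution is classical and unique for t < 1; K2″ is a statement about the ν > 0 linearised flow on
compac

History (route lifecycle, newest last):
- 2026-08-26T05:48:57Z · rev 8: restated Assembly (stmt-AnomalousDissipation-20028) — EDIT-4c (ad-ideate-p2 gen 6): restate the rev-0 Assembly (was K1BoundedStrainCascade → K2LinearisedCascadeGrowth → K3NonlinearClosure → Target over items that a (planner-ad-ideate-p2-g6-0)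
- 2026-08-26T09:57:14Z · closes_target -> closes rung F-D1.BDL of AnomalousDissipation: Summit.AnomalousDissipation.AnomalousDissipation.Theses.SawtoothPulseCascade.Target (D-0061; not the summit Statement) (planner-ad-ideate-p2-g7-0)
- 2026-08-26T16:30:54Z · rev 12: restated K2LinearisedCascadeGrowth (stmt-AnomalousDissipation-20025) — rev 12 = part (b)+(c)+(d) of the director-ordered combined edit [ad-ideate-p2 g8] (ruling 2026-08-26T12:52:36Z/13:14:03Z): the rev-11 op carried split+restate+i (planner-ad-ideate-p2-g8-0)
- 2026-08-26T16:30:54Z · rev 12: informal re-worded for K1LocalisedCascade, K3LocalisedClosure (planner-ad-ideate-p2-g8-0)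
- 2026-09-05T01:59:12Z · DORMANT — reconciler: no traction for 5 d (last activity item-evidence-added at 2026-08-31T01:04:31Z); parked, not closed — `ledger route dormant route-AnomalousDissipati (operator:999:1019492)

sub-problem: AnomalousDissipation · status: dormant · opened planner-ad-ideate-p2-g3-0 2026-08-25T23:28:54Z · rev 12 · ledger route-AnomalousDissipation-SawtoothPulseCascade
GENERATED by the gate from the ledger (D-0016/17). Provers cite these decls: `theorem foo : Summit.AnomalousDissipation.AnomalousDissipation.Theses.SawtoothPulseCascade.<Decl> := …` in Summits/AnomalousDissipation/AnomalousDissipation/Theorems/<Name>.lean.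
-/

namespace Summit.AnomalousDissipation.AnomalousDissipation.Theses.SawtoothPulseCascade

open scoped BigOperators Topology Manifold Classical MeasureTheory ProbabilityTheory Matrix InnerProductSpace ComplexConjugate ContinuousMap
open Filter Set Function TopologicalSpace MeasureTheory

attribute [summit_statement] _root_.AnomalousDissipation
-- H21.Audit: the closer leaf Summit.AnomalousDissipation.AnomalousDissipation.Theses.SawtoothPulseCascade.Target is an item decl of this route file — tagged summit_statement below, after its declaration

open Literature.Turb

/-- item stmt-AnomalousDissipation-20024 · target · rank 0 · open · by planner
why it might fail: BDL Question 2.1 is open in print: every construction to date (BDL23, BCCDS, JS24 Thm 1.5, Cheskidov–Peng) needs ν-dependent forces; a Hölder-in-time fixed force may be too rigid to drive a singular-time cascade whose viscous error stays perturbative.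
sources: BrueDeLellisCMP2023, arXiv:2212.08413, arXiv:2409.03599
[target] the class rung BDLQ21Holder (Brué–De Lellis Question 2.1 with a Hölder force), body
VERBATIM from the referee-endorsed leaf HOME/ad-ideate-p2/leaf/BDLQ21Holder.lean (sha 1986b449):
vanishing viscosities ν_m, ONE smooth datum u₀ and ONE ν-independent force f on [0,1] × T³ — f ∈
C([0,1]; C^α) with sup_t ‖f(t)‖_{C^α} < ∞ for every α < 1 and C^∞ on [0,1) × T³ — classical
solutions on [0,1) that are forced weak solutions on [0,1] from u₀, with non-vanishing mean
dissipation. `Target ↔ Summit.AnomalousDissipation.AnomalousDissipation.BDLQ21Holder` is `Iff.rfl`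
once the prover seat lands the leaf (Sketch-tree.lean `target_iff_leaf`). -/
@[route_item "route-AnomalousDissipation-SawtoothPulseCascade"]
def Target : Prop :=
  ∃ (ν : ℕ → ℝ) (u₀ : UnitAddTorus (Fin 3) → EuclideanSpace ℝ (Fin 3)) (f : ℝ → UnitAddTorus (Fin 3) → EuclideanSpace ℝ (Fin 3)) (u : ℕ → ℝ → UnitAddTorus (Fin 3) → EuclideanSpace ℝ (Fin 3)) (p : ℕ → ℝ → UnitAddTorus (Fin 3) → ℝ), Literature.Analysis.FluidPDE.IsVanishingViscosity ν ∧ Literature.Analysis.FunctionSpaces.Torus.IsSmooth u₀ ∧ (∀ α : NNReal, α < 1 → (∃ C : ENNReal, C < ⊤ ∧ ∀ t ∈ Set.Icc (0 : ℝ) 1, Literature.Analysis.FunctionSpaces.eBoundedHolderNorm α (f t) ≤ C) ∧ Literature.Analysis.FunctionSpaces.ContinuousInHolderOn (Set.Icc 0 1) α f) ∧ Literature.Analysis.FunctionSpaces.Torus.IsSmoothSpaceTimeOn (Set.Ico 0 1) f ∧ (∀ m, Literature.Analysis.FunctionSpaces.Torus.IsClassicalNSSolutionOn (Set.Ico 0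 1) (ν m) f (u m) (p m) ∧ u m 0 = u₀ ∧ Literature.Analysis.FluidPDE.Torus.IsWeakNSSolutionForcedOn 1 (ν m) f u₀ (u m)) ∧ Literature.Analysis.FluidPDE.HasAnomalousDissipation ν u

-- earlier K2LinearisedCascadeGrowth (stmt-AnomalousDissipation-20025, replaced 2026-08-26T16:30:54Z -> stmt-AnomalousDissipation-19696): retired by None — ∀ γ ∈ Set.Icc (4 : ℝ) 8, ∀ ρN ∈ Finset.Icc 2 7, Literature.Analysis.FluidPDE.SawtoothCascade.K2PhaseGrowth ⟨γ, 1 / 4, 2, 1, ρN⟩ 3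
/-- item stmt-AnomalousDissipation-19696 · crux · rank 2 · open · by planner
why it might fail: Orr transient + the deep-cascade cross channel (H-slot shear acting on the ∥ comb) could compound above 3e^{σ⋆γ} per phase at some lag, uniformly in ν (tightest at γ = 4; TEST E: G_lip ≤ 295 vs room ≥ 1860 on the box says no); and ∃ν₀ ∀j₀ needs exact self-similarity of the phase windows.
sources: YoshidaKaneda2000, Drazin2002, BrueDeLellisCMP2023
[crux] K2″ (CLASSICAL typing — rev-11 restate per director-frontier ruling 2026-08-26T12:52:36Z /
ad-lit L8; replaces the weak-class `K2PhaseGrowth` body 1:1: same datum class, same quantifier order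
∃ν₀ ∀j₀, same constant 3, same phase windows): for every γ ∈ [4,8] and ρN ∈ {2..7} there is ν₀ > 0
such that for all ν ∈ (0,ν₀], every injection phase j₀, every shear-comb residual-class datum v₀ at
phase j₀ (cross-stream Fourier support on odd multiples of N_{j₀}, comb parallel or perpendicular to
the running pulse) and every CLASSICAL solution v ∈ C^∞([0,∞) × 𝕋²) of Navier–Stokes linearised at
the time-shifted cascade carrier ū(·+tInject j₀) (`CascadeParams.IsClassicalLinearisedNS`: ∂ₜv +
ū·∇v + v·∇ū + ∇q = νΔv, div v = 0, v(0) = v₀), ∫|v(t)|² ≤ (3e^{0.30982γ})^{2(J−j₀+1)} ∫|v₀|² for t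
in the phase-J window, all J ≥ j₀ — `K2PhaseGrowthClassical ⟨γ,¼,2,1,ρN⟩ 3` (defn p446966, monotone
in the constant: `.mono`). Why the restate: the weak-class body quantified over ALL weak solutions
of the linearised problem and so silently contained a weak-class uniqueness statement nobody intends
to prove; classical solutions against the smooth, compactly-bounded carrier are unique by the energy
ident -/
@[route_item "route-AnomalousDissipation-SawtoothPulseCascade"]
def K2LinearisedCascadeGrowth : Prop :=
  ∀ γ ∈ Set.Icc (4 : ℝ) 8, ∀ ρN ∈ Finset.Icc 2 7, Literature.Analysis.FluidPDE.SawtoothCascade.K2PhaseGrowthClassical ⟨γ, 1 / 4, 2, 1, ρN⟩ 3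

/-! Retired items kept as plain definitions (history; not obligations of this route): landed proofs / closed glue still name them. -/

/-- retired stmt-AnomalousDissipation-19688 (moot, gen 1) — named by an active item. -/
def ApproxSol58 : Prop :=
  K2LinearisedCascadeGrowth → ∀ γ ∈ Set.Icc (5 : ℝ) 8, ∀ ρN ∈ Finset.Icc 2 7, Literature.Analysis.FluidPDE.SawtoothCascade.DriftFree.ApproximateSolution ⟨γ, 1 / 4, 2, 1, ρN⟩ (γ ^ 2 - 3)

/-- item stmt-AnomalousDissipation-19491 · crux · rank 3 · open · by planner
why it might fail: the floor γ²−3 alone gives no FIXED lag A (tHalf J ~ J⁻⁴ needs r^{2A} ≳ J⁴): the proof must use that the bulk of the variance grows at the typical rate ≈ √(γ⁴−4) > γ²−3 (strip-mass / large deviations across rounded corners ~3 wavelengths wide); viscous dephasing could refill low horizontal modes.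
sources: DEIJ2022, ElgindiLiss2024, JohanssonSorella2024, arXiv:2305.05048
[crux] K1loc — the LOCALISED scalar crux the closure actually consumes (ROUND-3 finding F1; rev 5
replaces the rev-0 by-t = 1 item K1BoundedStrainCascade, now an aside): for every γ ∈ [5,8] and ρN ∈
{2,…,7} (δ₀ = ¼, d = 2, N₀ = 1) the cascade field is smooth on [0,1) × 𝕋² (tree theorem
`SawtoothCascade.cascadeFieldSmooth` since p424921) AND `K1Localised ⟨γ,¼,2,1,ρN⟩ (γ²−3)` (tree Part
8): there are χ > 0, a lag A and κ₀ > 0 such that every classical solution of ∂ₜw + ū·∇w = κΔw on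
[0,1) from sin 2πx₁ with κ ∈ (0, κ₀] has dissipated at least χ·‖sin 2πx₁‖² (twice the cumulative
dissipation, extended-real form) BY THE TIME tStart(J_{γ²−3}(κ) + A), J_r(κ) = ⌈log(1/κ)/(2 log r)⌉₊
(`Jrate`) the r-dissipation threshold phase. Rate of record r = γ²−3 = the tree-certified
per-pulse-pair growth floor of scalar gradients off the corner strips (`itinJac_growth_two`, γ² ≥ 8;
the γ-independent 13ⁿ floor for γ ≥ 4 is `itinJac_growth_routeBox`). Registered line
`Cruxes.K1LocalisedCascade.Spectral` (horizontal spectral threshold: H half-slot = one horizontal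
shear ⇒ horizontal Fourier fibres decouple and the modes |k₁| ≥ K lose the fraction 1 −
e^{−8π²κK²tHalf j}; the heart is the high-horizontal-m -/
@[route_item "route-AnomalousDissipation-SawtoothPulseCascade"]
def K1LocalisedCascade : Prop :=
  ∀ γ ∈ Set.Icc (5 : ℝ) 8, ∀ ρN ∈ Finset.Icc 2 7, Literature.Analysis.FluidPDE.SawtoothCascade.CascadeFieldSmooth ⟨γ, 1 / 4, 2, 1, ρN⟩ ∧ Literature.Analysis.FluidPDE.SawtoothCascade.K1Localised ⟨γ, 1 / 4, 2, 1, ρN⟩ (γ ^ 2 - 3)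

/-- item stmt-AnomalousDissipation-19492 · crux · rank 4 · closed · proved by Summit.AnomalousDissipation.AnomalousDissipation.Theorems.SawtoothPulseCascade.k3LocalisedClosure_proof (prover) · by planner
why it might fail: the nonlinear and residual sources are not exactly comb-class; realigning injections to phase starts costs a per-phase constant that must also fit under (γ²−3)²; and the forced energy bookkeeping up to t = 1 (force only Hölder there) could let the planar perturbation carry or cancel dissipation.
sources: BrueDeLellisCMP2023, JohanssonSorella2024, Drazin2002
retired/moot children: ApproxSol58 [moot: K2LinearisedCascadeGrowth → ∀ γ ∈ Set.Icc (5 : ℝ) 8, ∀ ρN ∈ Finset.Icc 2 7, Lite]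
[crux] K3loc — the LOCALISED closure (ROUND-3 §4): the localised scalar crux K1loc and the
linearised per-phase Kelvin–Helmholtz cap K2″ imply the Target. SPLIT ×3 (rev 11, director-frontier
ruling 2026-08-26T12:52:36Z, J addendum-1 feedback (3): split before K1loc/K2″ land) along the
lead's REGISTERED line `Cruxes.K3LocalisedClosure.DriftFree` v3.2 (skeleton sha ced323057a45;
composition `K3LocalisedClosure_of` kernel-checked): Packaging58 (support; = stub_regularity p445324
∧ stub_existence p452816: smooth datum/force regularity + global classical planar NS from rest for
every ν > 0, Ladyzhenskaya) → ApproxSol58 (crux, the ONE open XL piece; = stub_approximateSolution: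
K2″ ⇒ Grenier approximate solution U = ū + linearised response within εν of the carrier up to phase
J_{γ²−3}(ν)+A, `DriftFree.ApproximateSolution`; by p450527 equivalent, given Existence, to the bare
slaving estimate ∫‖V_ν−ū‖² ≤ εν) → DriftFreeClosure58 (support; = stub_driftFreeClosure LANDED
p444010: NS energy stability + drift-free scalar comparison + K1loc fraction ⇒ planar anomalous
family) → K3loc, glue = 2½-D lift by the tree theorem `DriftFree.liftClassical` (`Torus.twoHalf`,
datum `liftedDatum` = (0,0,sin -/
@[route_item "route-AnomalousDissipation-SawtoothPulseCascade"]
def K3LocalisedClosure : Prop :=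
  K1LocalisedCascade → K2LinearisedCascadeGrowth → Target

-- `K3LocalisedClosure` holds: proved by `Summit.AnomalousDissipation.AnomalousDissipation.Theorems.SawtoothPulseCascade.k3LocalisedClosure_proof` (its module imports this route file, so no `_holds` link can be stated here).

-- parent: K3LocalisedClosure · child (gen 1)
/--     item stmt-AnomalousDissipation-19687 · support · rank 401 · closed · proved by Summit.AnomalousDissipation.AnomalousDissipation.Theorems.SawtoothPulseCascade.packaging58_proof (planner)
    parent: K3LocalisedClosure · by planner
    sources: Ladyzhenskaya1959, BrueDeLellisCMP2023
[support, child of K3loc — the conjunction of the registered stubs `stub_regularity` ∧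
`stub_existence` of line DriftFree v3.2, BOTH LANDED] packaging on the box [5,8]×{2..7}: (i)
`DriftFree.ConstructionRegular` — the lifted datum (0,0,sin 2πx₁)∘π is smooth, the lifted force
(∂ₜū,0)∘π is jointly smooth on [0,1) × 𝕋³ and C^α-bounded and C^α-continuous up to t = 1 for every α
< 1 (p445324 `Theorems.stub_regularity`, alias `constructionRegular58`); (ii) `DriftFree.Existence`
— for every ν > 0 a global classical planar Navier–Stokes solution from rest forced by ∂ₜū with its
transported scalar from sin 2πx₁, the forced weak formulation of the 2½-D lift on [0,1] and the
cascade scalar (p452816 `Theorems.SawtoothPulseCascade.DriftFreeExistence.stub_existence`,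
Ladyzhenskaya 2D via `Torus.exists_classicalNS_forced_fin_two` p452019). Closes on birth by
`⟨stub_regularity, stub_existence⟩` (planner Sketch, farm rc 0). [difficulty: S — citation] -/
@[route_item "route-AnomalousDissipation-SawtoothPulseCascade"]
def Packaging58 : Prop :=
  (∀ γ ∈ Set.Icc (5 : ℝ) 8, ∀ ρN ∈ Finset.Icc 2 7, Literature.Analysis.FluidPDE.SawtoothCascade.DriftFree.ConstructionRegular ⟨γ, 1 / 4, 2, 1, ρN⟩) ∧ (∀ γ ∈ Set.Icc (5 : ℝ) 8, ∀ ρN ∈ Finset.Icc 2 7, Literature.Analysis.FluidPDE.SawtoothCascade.DriftFree.Existence ⟨γ, 1 / 4, 2, 1, ρN⟩)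

-- `Packaging58` holds: proved by `Summit.AnomalousDissipation.AnomalousDissipation.Theorems.SawtoothPulseCascade.packaging58_proof` (its module imports this route file, so no `_holds` link can be stated here).

-- parent: K3LocalisedClosure · child (gen 1)
/--     item stmt-AnomalousDissipation-19689 · support · rank 403 · closed · proved by Summit.AnomalousDissipation.AnomalousDissipation.Theorems.SawtoothPulseCascade.driftFreeClosure58_proof (planner)
    parent: K3LocalisedClosure · by planner
    sources: JohanssonSorella2024
[support, child of K3loc — verbatim the registered stub `stub_driftFreeClosure` of line DriftFree
v3.2, LANDED p444010 `Theorems.SawtoothPulseCascade.DriftFreeClosure.stub_driftFreeClosure`] the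
drift-free closure (Johansson–Sorella Lemma 2.2 bookkeeping, no balanced growth, no duality): K1loc,
the existence package and the approximate solutions on the box give
`DriftFree.PlanarAnomalousFamily` at every box point — along ν_m ↓ 0: the tree's NS energy stability
`DriftFree.nsEnergyStability` turns the approximate solution into ∫‖V_ν−U‖² ≲ εν, the drift-free
scalar comparison gives ‖θ^V(T) − θ̄(T)‖² ≤ 4ε at the horizon, K1loc's fraction χ (rate γ²−3, lag A,
κ₀) gives 2ν∫₀ᵀ‖∇θ^V‖² ≥ (5χ/12)‖θ₀‖² for ε small, and the lift's dissipation dominates the scalar's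
and is integrable to t = 1 by the force bound ⇒ HasAnomalousDissipation of the planar family. Closes
on birth by citation (planner Sketch, farm rc 0). [difficulty: M — done] -/
@[route_item "route-AnomalousDissipation-SawtoothPulseCascade"]
def DriftFreeClosure58 : Prop :=
  K1LocalisedCascade → (∀ γ ∈ Set.Icc (5 : ℝ) 8, ∀ ρN ∈ Finset.Icc 2 7, Literature.Analysis.FluidPDE.SawtoothCascade.DriftFree.Existence ⟨γ, 1 / 4, 2, 1, ρN⟩) → (∀ γ ∈ Set.Icc (5 : ℝ) 8, ∀ ρN ∈ Finset.Icc 2 7, Literature.Analysis.FluidPDE.SawtoothCascade.DriftFree.ApproximateSolution ⟨γ, 1 / 4, 2, 1, ρN⟩ (γ ^ 2 - 3)) → ∀ γ ∈ Set.Icc (5 : ℝ) 8, ∀ ρN ∈ Finset.Icc 2 7, Literature.Analysis.FluidPDE.SawtoothCascade.DriftFree.PlanarAnomalousFamily ⟨γ, 1 / 4, 2, 1, ρN⟩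

-- `DriftFreeClosure58` holds: proved by `Summit.AnomalousDissipation.AnomalousDissipation.Theorems.SawtoothPulseCascade.driftFreeClosure58_proof` (its module imports this route file, so no `_holds` link can be stated here).

-- parent: K3LocalisedClosure · glue (gen 1)
/--     item stmt-AnomalousDissipation-19690 · support · rank 404 · closed · proved by Summit.AnomalousDissipation.AnomalousDissipation.Theorems.SawtoothPulseCascade.k3LocalisedClosureGlue_proof (planner)
    parent: K3LocalisedClosure · GLUE: children ⟹ parent · by planner
kind glue: body of the kernel-checked composition `K3LocalisedClosure_of` of the lead's registered
DriftFree skeleton v3.2 (sha ced323057a45), re-checked verbatim over these three children as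
`SplitSketch.k3LocalisedClosure_of_children` in the planner's Sketch (farm rc 0, axioms
propext/Classical.choice/Quot.sound): intro hP hA hD hK1 hK2; unpack ConstructionRegular at the box
point (γ,ρN) = (5,2); happ := hA hK2; hfam := hD hK1 hP.2 happ at (5,2) ⇒ ν_m, V, φ, R, AD; refine
the Target with datum `DriftFree.liftedDatum`, force `DriftFree.liftedForce ⟨5,¼,2,1,2⟩`, velocity
`Torus.twoHalf (V m t) (R m t)`, pressure φ∘`Torus.planarProj`; classical NS of the lift by the tree
theorem `DriftFree.liftClassical`, initial datum by rewriting V m 0, R m 0 — 15 lines, no analysis. -/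
@[route_item "route-AnomalousDissipation-SawtoothPulseCascade"]
def K3LocalisedClosureGlue : Prop :=
  Packaging58 → ApproxSol58 → DriftFreeClosure58 → K3LocalisedClosure

-- `K3LocalisedClosureGlue` holds: proved by `Summit.AnomalousDissipation.AnomalousDissipation.Theorems.SawtoothPulseCascade.k3LocalisedClosureGlue_proof` (its module imports this route file, so no `_holds` link can be stated here).

/-- item stmt-AnomalousDissipation-20026 · aside · rank 3 · open · by planner
why it might fail: with BOUNDED strain per pulse a fixed fraction of scalar variance may fail to reach frequency N_j by phase j (imperfect mixing compounds; balanced growth ‖Δg‖ ≤ C‖∇g‖² may fail by spectral delocalisation), so the dissipated fraction could decay to 0 as κ → 0 at the small-γ corner of the box.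
sources: arXiv:2305.05048, ElgindiLissMattingly2023, BrueDeLellisCMP2023
[crux] K1 — for every γ ∈ [4,8], ρN ∈ {2..7} (δ₀ = ¼, d = 2, N₀ = 1) the cascade field is smooth on
[0,1) × 𝕋² and the passive scalar sin 2πx₁ it advects dissipates at least a fixed fraction χ > 0 of
its variance on [0,1] (classical solutions on [0,1)), uniformly in small diffusivity κ ∈ (0, κ₀].
[difficulty: L] -/
@[route_item "route-AnomalousDissipation-SawtoothPulseCascade"]
def K1BoundedStrainCascade : Prop :=
  ∀ γ ∈ Set.Icc (4 : ℝ) 8, ∀ ρN ∈ Finset.Icc 2 7, Literature.Analysis.FluidPDE.SawtoothCascade.CascadeFieldSmooth ⟨γ, 1 / 4, 2, 1, ρN⟩ ∧ Literature.Analysis.FluidPDE.SawtoothCascade.K1FixedFraction ⟨γ, 1 / 4, 2, 1, ρN⟩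

/-- item stmt-AnomalousDissipation-20027 · aside · rank 4 · open · by planner
why it might fail: the linear budget may not close nonlinearly: KH-eigenmode projection efficiencies, the drift error V_ν − ū against the GROWING scalar gradient phase by phase, and the forced energy bookkeeping up to t = 1 (force only Hölder there) could let the planar perturbation carry or cancel the dissipation.
sources: BrueDeLellisCMP2023, arXiv:2409.03599, arXiv:2305.05048
[crux] K3′ — bounded-strain scalar mixing (K1) and phase-by-phase slaving of the linearised response
(K2″) imply the Target: planar Navier–Stokes V_ν forced by the ν-independent ∂ₜū from rest stays
slaved to ū phase by phase (nonlinear remainder under the budget 3e^{σ⋆γ} < γ² − 2), the scalar sin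
2πx₁ transported by V_ν with diffusivity ν keeps K1's fixed dissipated fraction, and the 2½-D lift
u_ν = (V_ν, θ_ν)∘π (tree: `Torus.twoHalf`, `Torus.isClassicalNSSolutionOn_twoHalf`) is the Target's
family with f = (∂ₜū, 0)∘π (C^∞ on [0,1), Hölder up to t = 1) and u₀ = (0, 0, sin 2πx₁)∘π. [deps:
K1BoundedStrainCascade, K2LinearisedCascadeGrowth] [difficulty: XL] -/
@[route_item "route-AnomalousDissipation-SawtoothPulseCascade"]
def K3NonlinearClosure : Prop :=
  K1BoundedStrainCascade → K2LinearisedCascadeGrowth → Target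

/-- item stmt-AnomalousDissipation-19094 · support · rank 9 · closed · proved by Summit.AnomalousDissipation.AnomalousDissipation.Theorems.sawtoothSigmaMax_proof (prover) · by planner
[support] certified maximal normalised Kelvin–Helmholtz rate of the exact triangle-wave shear:
k²(−c²(k,0)) ≤ 0.3099² for all k > 0 — by the landed half-angle/product form `sq_mul_neg_sawC2zero`
/ `sawC2_eq_sawC2prod` (AMENDMENT 2 p411296) this is a one-variable bound on (x − tanh x)(coth x −
x), x = πk/2: interval arithmetic (cert data HOME/ad-ideate-p2/cert/). Registered stub
`stub_sawtoothSigmaMax` of K2″ (stmt-AnomalousDissipation-20025); implies the Bloch sup via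
`sq_mul_neg_sawC2_le_max`. Sources: Drazin2002 §8 (piecewise-linear profiles); BrueDeLellisCMP2023. -/
@[route_item "route-AnomalousDissipation-SawtoothPulseCascade"]
def SawtoothSigmaMax : Prop :=
  ∀ k : ℝ, 0 < k → k ^ 2 * (-(Literature.Analysis.FluidPDE.SawtoothCascade.sawC2zero k)) ≤ (0.3099 : ℝ) ^ 2

-- `SawtoothSigmaMax` holds: proved by `Summit.AnomalousDissipation.AnomalousDissipation.Theorems.sawtoothSigmaMax_proof` (its module imports this route file, so no `_holds` link can be stated here).

/-- item stmt-AnomalousDissipation-19496 · support · rank 9 · closed · proved by Summit.AnomalousDissipation.AnomalousDissipation.Theorems.closureMargin58_proof (prover) · by planner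
why it might fail: cannot fail mathematically (margin ≥ 21 % on [5,8], sup ratio 0.7867 at γ = 5, referee-verified); the only risk is a typing slip in the inlined envelope or the exp argument — decidable by interval arithmetic at the endpoints.
sources: Drazin2002, BrueDeLellisCMP2023
[support; in-cone as stub S0 `stub_closureMargin58` of the registered K3loc line
`Cruxes.K3LocalisedClosure.Loc58`; provable now] the LOCALISED CLOSURE WINDOW on the rev-5 box
(ROUND-3 §4.3): for every γ ∈ [5,8], 3·e^{σ⋆γ}·‖B(γ)‖ < (γ²−3)², where σ⋆ = sawSigmaStar = 0.30982
is the certified maximal Kelvin–Helmholtz rate per unit strain (cap 3e^{σ⋆γ} per phase of K2″),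
‖B(γ)‖ = ((γ²+2)+√((γ²+2)²−4))/2 is the largest singular value of the exact pulse-pair Jacobian
[[1+γ², ∓γ],[∓γ, 1]] (the per-phase sup-gradient envelope), and γ²−3 is the tree-certified
per-pulse-pair growth floor of scalar gradients off the corner strips
(`SawtoothCascade.itinJac_growth_routeBox`). Elementary real analysis: float ratios 0.787 / 0.715 /
0.671 / 0.634 at γ = 5 / 5.5 / 6 / 8, sup on [5,8] = 0.7867 at γ = 5, crossing at γ ≈ 4.218 (fails
at γ = 4: 185.9 > 169 — whence the box [5,8]); eight monotone sub-intervals with `Real.exp` bounds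
suffice (certificate style of the landed `sq_mul_neg_sawC2zero_le`). -/
@[route_item "route-AnomalousDissipation-SawtoothPulseCascade"]
def ClosureMargin58 : Prop :=
  ∀ γ ∈ Set.Icc (5 : ℝ) 8, 3 * Real.exp (Literature.Analysis.FluidPDE.SawtoothCascade.sawSigmaStar * γ) * (((γ ^ 2 + 2) + Real.sqrt ((γ ^ 2 + 2) ^ 2 - 4)) / 2) < (γ ^ 2 - 3) ^ 2

-- `ClosureMargin58` holds: proved by `Summit.AnomalousDissipation.AnomalousDissipation.Theorems.closureMargin58_proof` (its module imports this route file, so no `_holds` link can be stated here).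

-- earlier Assembly (stmt-AnomalousDissipation-20028, replaced 2026-08-26T05:48:57Z -> stmt-AnomalousDissipation-19497): retired by None — K1BoundedStrainCascade → K2LinearisedCascadeGrowth → K3NonlinearClosure → Target
/-- item stmt-AnomalousDissipation-19497 · assembly · rank 1 · closed · proved by Summit.AnomalousDissipation.AnomalousDissipation.Theorems.sawtoothPulseCascade_assembly_proof (prover) · by planner
sources: BrueDeLellisCMP2023
[assembly, optional; NOT the deciding theorem and NOT a binder of closes since rev 6] the rev-5
thesis as one implication: K1loc → K2″ → K3loc → Target — modus ponens (K3loc is itself the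
implication K1loc → K2″ → Target), provable by `fun a b c => c a b`; kept only because an assembly
item can be neither dropped nor retriaged; the deciding theorem is the crux-only `closes (hK1) (hK2)
(hK3) : Target := hK3 hK1 hK2`. -/
@[route_item "route-AnomalousDissipation-SawtoothPulseCascade"]
def Assembly : Prop :=
  K1LocalisedCascade → K2LinearisedCascadeGrowth → K3LocalisedClosure → Target

-- `Assembly` holds: proved by `Summit.AnomalousDissipation.AnomalousDissipation.Theorems.sawtoothPulseCascade_assembly_proof` (its module imports this route file, so no `_holds` link can be stated here).

attribute [summit_statement] _root_.Summit.AnomalousDissipation.AnomalousDissipation.Theses.SawtoothPulseCascade.Target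

/-! D-0027 §2.1 — DECIDING THEOREM (planner-authored via `route open/edit --closes-file`; by planner-ad-ideate-p2-g7-0 2026-08-26T09:57:14Z):
its hypotheses are this route's items and its conclusion the registered leaf `Summit.AnomalousDissipation.AnomalousDissipation.Theses.SawtoothPulseCascade.Target` (rung F-D1.BDL, D-0061) (glue_lint), and it elaborates with this file. -/

@[closes "route-AnomalousDissipation-SawtoothPulseCascade"] theorem closes (hK1 : K1LocalisedCascade) (hK2 : K2LinearisedCascadeGrowth)
    (hK3 : K3LocalisedClosure) : Target :=
  hK3 hK1 hK2

end Summit.AnomalousDissipation.AnomalousDissipation.Theses.SawtoothPulseCascade
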